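import Literature.AlgebraicGeometry.GroupSchemes.AdmissibleIdealSpecialFibre
import Literature.AlgebraicGeometry.GroupSchemes.AffineGroupSchemeBaseChangeHopf
import Literature.AlgebraicGeometry.GroupSchemes.GroupSchemeKernelAlg
import Literature.AlgebraicGeometry.GroupSchemes.GroupSchemeKernelBaseChange
import Literature.AlgebraicGeometry.GroupSchemes.CanonicalLineAssembly
import HarnessLib

/-!
# KERNELS SPECIALISE: a homomorphism of affine group schemes killing a closed subgroup of the generic fibre kills its specialisation
# ([EGAIV2] Prop. 2.8.5; [Tate1997FiniteFlatGroupSchemes] (3.7); [Waterhouse1979] §2.1)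

Topic `Literature/AlgebraicGeometry/GroupSchemes`; namespace `Literature.AlgebraicGeometry.GroupSchemes.AffineGroupScheme`.  THEOREMS ONLY (no
definition, no instance, no notation, no named fact, no `sorry`).  Cell `hodgecm-mathlib` (D-0151), programme P6 «MOD» (crux hLiu418 =
stmt-HodgeConjecture-24832, `--supports`, count-neutral): organ **(O-K) «KERNELS SPECIALISE»** of the D-line `stub_DOWN` payer (LEAD F0P6-plan (g3)
deal 2026-09-02T01:19:25Z; census memo `F0/P6/B-p08/g34/MEMO-stubDOWN-census.v1.B-p08g34.md`): the input «the reduced quotient isogeny `q̄` kills the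
specialised line `sp y L`» of the rows `IsogKerLaw` (via ★ `IdealKernelLayerMap` L4) and of the kernel clause that (L1′) `inj₀` reads on the reduced roof
(`red_quotΩ` ∕ `red_translΩ` well-definedness), in the Hopf-ideal currency of ★ `AdmissibleIdealSpecialFibre` (`spI`) and ★ `GroupSchemeKernelAlg`
(the kernel ideal `J(φ) = Γ(φ)(Γ(G₂)⁺)·Γ(G₁) = ker Γ(Ker φ ↪ G₁)`).  HC_CM is proved only modulo the printed citations until rung 0 closes; generic, no count.

THE MATHEMATICS.  `φ : G₁ → G₂` a homomorphism of affine group schemes over a commutative ring `R`; for an `R`-algebra `S` write `φ_S`, `e_S :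
Γ(G_S) ≅ S ⊗_R Γ(G)` (★ `algBaseChangeEquiv`).  (§1) The closed subgroup `V(I) = Spec (Γ(G₁) ⧸ I) ↪ G₁` is killed by `φ` iff `J(φ) ≤ I` (points criterion ★
`exists_comp_kerι_eq_iff_map_ker_counit_le` at the test point ★ `quotIncl`, ★ `kerLift`).  (§2) KERNELS COMMUTE WITH BASE CHANGE in ideal form:
`e_S⁻¹(J(φ)·(S ⊗ Γ(G₁))) = J(φ_S)` — the ideal of `(Ker φ)_S = Ker (φ_S)` (★ `GroupSchemeKernel.baseChangeIso`, ★ `CanonicalLine.comap_algBaseChangeEquiv_map_includeRight_ker_eq`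
on the closed immersion `Ker φ ↪ G₁`, ★ `ker_appTop_kerι_eq`).  Hence for fields `K`, `κ` over `R` the specialisation map `spI` of ★ `AdmissibleIdealSpecialFibre`
(`spI J = e_κ⁻¹((e_K J ∩ Γ(G₁))·(κ ⊗ Γ(G₁)))`) satisfies `J(φ_κ) ≤ spI (J(φ_K))` (`Γ(G₁)·J(φ) ⊆ e_K J(φ_K) ∩ Γ(G₁)`), `spI` is monotone, and therefore
(HEAD) `quotIncl _ J ≫ φ_K = 1 ⇒ quotIncl _ (spI J) ≫ φ_κ = 1`: A HOMOMORPHISM KILLING A CLOSED SUBGROUP OF THE GENERIC FIBRE KILLS ITS SPECIALISATION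
([EGAIV2] 2.8.5: `V(spI J)` is the special fibre of the schematic closure of `V(J)`; [Tate1997FiniteFlatGroupSchemes] (3.7)).

* §1 `quotIncl_comp_eq_one_iff_map_ker_counit_le` (kills criterion);
* §2 `spI_mono`, `algBaseChangeEquiv_symm_one_tmul_mem_ker_counit` (`e_S⁻¹(1 ⊗ b) ∈ Γ(G_S)⁺` for `b ∈ Γ(G)⁺`, ★ `counitAlgHom_comp_algBaseChangeEquiv`),
  **`comap_algBaseChangeEquiv_map_includeRight_map_ker_counit_eq`** (kernel ideals commute with base change), **`map_ker_counit_pullback_le_spI`**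
  (`J(φ_κ) ≤ spI (J(φ_K))`), HEAD **`quotIncl_spI_comp_eq_one`**.
* §3 (ED. 2) `comap_map_includeRight_eq_self_of_flat_quotient`, HEAD **`spI_map_ker_counit_pullback_eq`** — the EQUALITY `spI (J(φ_K)) = J(φ_κ)` when `Γ(Ker φ)` and `Γ(G₁)` are flat over a valuation ring (★
`FlatClosedSubgroupOfGenericFibre` §1 for the scheme form) — «the kernel of the special fibre IS the specialisation of the generic kernel».

## References
* [EGAIV2] A. Grothendieck, J. Dieudonné, *ÉGA* IV₂, Publ. Math. IHÉS 24 (1965), Prop. 2.8.5.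
* [Tate1997FiniteFlatGroupSchemes] J. Tate, *Finite flat group schemes* (1997), (3.7).
* [Waterhouse1979] W. C. Waterhouse, *Introduction to Affine Group Schemes*, GTM 66 (1979), §2.1 (p. 14).
* [GortzWedhorn2023] U. Görtz, T. Wedhorn, *Algebraic Geometry II* (2023), §(27.2) (27.2.1) (pp. 606–607).
* [GortzWedhorn2020] U. Görtz, T. Wedhorn, *Algebraic Geometry I*, 2nd ed. (2020), (4.15), Definition 4.45 (2) (p. 117).
-/

set_option autoImplicit false

set_option backward.isDefEq.respectTransparency false

universe u

open CategoryTheory CategoryTheory.Limits AlgebraicGeometry MonoidalCategory CartesianMonoidalCategory TensorProduct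

noncomputable section

namespace Literature.AlgebraicGeometry.GroupSchemes

namespace AffineGroupScheme

open scoped MonObj CategoryTheory.Obj

open Literature.AlgebraicGeometry.Motives GroupSchemeKernel

/-! ## §1 The kills criterion for the closed subgroup `V(I)` -/

section Kills

variable {R : Type u} [CommRing R] {G₁ G₂ : SchemeOver R} [GrpObj G₁] [GrpObj G₂] [IsAffine G₁.left] [IsAffine G₂.left]
  (φ : G₁ ⟶ G₂) (I : Ideal (Alg G₁))

omit [GrpObj G₁] in
/-- **KILLS CRITERION**: the closed subgroup `V(I) = Spec (Γ(G₁) ⧸ I) ↪ G₁` (★ `quotIncl`) is killed by `φ` iff the kernel ideal `J(φ) = Γ(φ)(Γ(G₂)⁺)·Γ(G₁)`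
lies in `I` (★ points criterion `exists_comp_kerι_eq_iff_map_ker_counit_le` + ★ `ptEquiv_quotIncl`, Mathlib `Ideal.mk_ker`; ★ `kerLift` ∕ `kerι_comp`).
[cite: Waterhouse1979, §2.1 (p. 14)] [cite: GortzWedhorn2020, Definition 4.45 (2) (p. 117)] -/
theorem quotIncl_comp_eq_one_iff_map_ker_counit_le :
    quotIncl G₁ I ≫ φ = 1 ↔ (RingHom.ker (Bialgebra.counitAlgHom R (Alg G₂))).map (Alg.comap φ) ≤ I := by
  have h := exists_comp_kerι_eq_iff_map_ker_counit_le φ (quotIncl G₁ I)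
  rw [ptEquiv_quotIncl] at h
  have hk : RingHom.ker (Ideal.Quotient.mkₐ R I).toRingHom = I := Ideal.mk_ker
  rw [hk] at h
  rw [← h]
  constructor
  · intro h1
    exact ⟨kerLift _ h1, kerLift_ι _ _⟩
  · rintro ⟨v, hv⟩
    rw [← hv, Category.assoc, kerι_comp, MonObj.comp_one]

end Kills

/-! ## §2 `spI` is monotone and the kernel ideal of the special fibre lies in the specialisation of the generic kernel ideal -/

section Specialise

variable {R : Type u} [CommRing R] (K κ : Type u) [Field K] [Algebra R K] [Field κ] [Algebra R κ]
  {G₁ G₂ : SchemeOver R} [GrpObj G₁] [GrpObj G₂] [IsAffine G₁.left] [IsAffine G₂.left] (φ : G₁ ⟶ G₂)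
  [IsAffine ((Over.pullback (Spec.map (CommRingCat.ofHom (algebraMap R K)))).obj G₁).left]
  [IsAffine ((Over.pullback (Spec.map (CommRingCat.ofHom (algebraMap R κ)))).obj G₁).left]
  [IsAffine ((Over.pullback (Spec.map (CommRingCat.ofHom (algebraMap R K)))).obj G₂).left]
  [IsAffine ((Over.pullback (Spec.map (CommRingCat.ofHom (algebraMap R κ)))).obj G₂).left]

omit [GrpObj G₂] [IsAffine G₂.left] in
/-- `spI` is monotone. [cite: EGAIV2, Prop. 2.8.5] -/
theorem spI_mono {J J' : Ideal (Alg ((Over.pullback (Spec.map (CommRingCat.ofHom (algebraMap R K)))).obj G₁))} (h : J ≤ J') :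
    spI K κ G₁ J ≤ spI K κ G₁ J' := by
  rw [spI_eq, spI_eq]
  exact Ideal.comap_mono (Ideal.map_mono (Ideal.comap_mono (Ideal.map_mono h)))

/-- `e_S⁻¹(1 ⊗ b)` lies in the augmentation ideal of `Γ(G_S)` when `b` lies in that of `Γ(G)` (★ `counitAlgHom_comp_algBaseChangeEquiv`, Mathlib `counit_tmul`).
[cite: GortzWedhorn2023, §(27.2) (27.2.1) (pp. 606–607)] -/
theorem algBaseChangeEquiv_symm_one_tmul_mem_ker_counit (S : Type u) [CommRing S] [Algebra R S]
    [IsAffine ((Over.pullback (Spec.map (CommRingCat.ofHom (algebraMap R S)))).obj G₂).left]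
    {b : Alg G₂} (hb : b ∈ RingHom.ker (Bialgebra.counitAlgHom R (Alg G₂))) :
    (algBaseChangeEquiv S G₂).symm ((1 : S) ⊗ₜ[R] b) ∈
      RingHom.ker (Bialgebra.counitAlgHom S (Alg ((Over.pullback (Spec.map (CommRingCat.ofHom (algebraMap R S)))).obj G₂))) := by
  rw [RingHom.mem_ker] at hb ⊢
  have h := AlgHom.congr_fun (counitAlgHom_comp_algBaseChangeEquiv S G₂) ((algBaseChangeEquiv S G₂).symm ((1 : S) ⊗ₜ[R] b))
  rw [AlgHom.comp_apply] at h
  rw [← h]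
  change Bialgebra.counitAlgHom S (S ⊗[R] Alg G₂) (algBaseChangeEquiv S G₂ ((algBaseChangeEquiv S G₂).symm ((1 : S) ⊗ₜ[R] b))) = 0
  rw [AlgEquiv.apply_symm_apply, Bialgebra.counitAlgHom_apply, TensorProduct.counit_tmul]
  rw [Bialgebra.counitAlgHom_apply] at hb
  rw [hb, zero_smul]

/-- **KERNEL IDEALS COMMUTE WITH BASE CHANGE**: `e_S⁻¹(J(φ)·(S ⊗_R Γ(G₁))) = J(φ_S)` — the left side is the ideal of `(Ker φ)_S ↪ (G₁)_S` (★
`CanonicalLine.comap_algBaseChangeEquiv_map_includeRight_ker_eq` for the closed immersion `Ker φ ↪ G₁`, ★ `ker_appTop_kerι_eq`), the right side that of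
`Ker (φ_S) ↪ (G₁)_S`, and `(Ker φ)_S ≅ Ker (φ_S)` over `(G₁)_S` (★ `GroupSchemeKernel.baseChangeIso`, `baseChangeIso_hom_comp_kerι`).
[cite: GortzWedhorn2020, (4.15) (p. 116) and Definition 4.45 (2) (p. 117)] [cite: Waterhouse1979, §2.1 (p. 14)] -/
theorem comap_algBaseChangeEquiv_map_includeRight_map_ker_counit_eq [IsMonHom φ] (S : Type u) [CommRing S] [Algebra R S]
    [IsAffine ((Over.pullback (Spec.map (CommRingCat.ofHom (algebraMap R S)))).obj G₁).left]
    [IsAffine ((Over.pullback (Spec.map (CommRingCat.ofHom (algebraMap R S)))).obj G₂).left] :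
    (((RingHom.ker (Bialgebra.counitAlgHom R (Alg G₂))).map (Alg.comap φ)).map
        (Algebra.TensorProduct.includeRight : Alg G₁ →ₐ[R] S ⊗[R] Alg G₁)).comap (algBaseChangeEquiv S G₁) =
      (RingHom.ker (Bialgebra.counitAlgHom S (Alg ((Over.pullback (Spec.map (CommRingCat.ofHom (algebraMap R S)))).obj G₂)))).map
        (Alg.comap ((Over.pullback (Spec.map (CommRingCat.ofHom (algebraMap R S)))).map φ)) := by
  haveI := isClosedImmersion_kerι_left_of_isAffine φ
  haveI : IsAffine (ker φ).left := isAffine_ker_left φ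
  haveI : IsAffine ((Over.pullback (Spec.map (CommRingCat.ofHom (algebraMap R S)))).obj (ker φ)).left := by
    change IsAffine (pullback _ _); infer_instance
  -- the ideal of `Ker φ` is `J(φ)`; its base change is the ideal of `(Ker φ)_S = Ker (φ_S)`
  have h1 := CanonicalLine.comap_algBaseChangeEquiv_map_includeRight_ker_eq S G₁ (ker φ) (kerι φ)
  have hk : (RingHom.ker (Alg.comap (kerι φ)).toRingHom : Ideal (Alg G₁)) =
      (RingHom.ker (Bialgebra.counitAlgHom R (Alg G₂))).map (Alg.comap φ) := ker_appTop_kerι_eq φ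
  rw [hk] at h1
  rw [h1]
  -- `(kerι φ)_S = (baseChangeIso).hom ≫ kerι (φ_S)` and `Γ(iso)` is injective
  have hb := (GroupSchemeKernel.baseChangeIso_hom_comp_kerι (Spec.map (CommRingCat.ofHom (algebraMap R S))) φ).symm
  haveI := isClosedImmersion_kerι_left_of_isAffine ((Over.pullback (Spec.map (CommRingCat.ofHom (algebraMap R S)))).map φ)
  haveI : IsAffine (ker ((Over.pullback (Spec.map (CommRingCat.ofHom (algebraMap R S)))).map φ)).left := isAffine_ker_left _
  rw [← ker_appTop_kerι_eq ((Over.pullback (Spec.map (CommRingCat.ofHom (algebraMap R S)))).map φ), hb, Alg.comap_comp]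
  have hinj : Function.Injective (Alg.comap (GroupSchemeKernel.baseChangeIso (Spec.map (CommRingCat.ofHom (algebraMap R S))) φ).hom) :=
    fun a b hab => by
      have h := congrArg (Alg.comap (GroupSchemeKernel.baseChangeIso (Spec.map (CommRingCat.ofHom (algebraMap R S))) φ).inv) hab
      rwa [← AlgHom.comp_apply, ← AlgHom.comp_apply, ← Alg.comap_comp, Iso.inv_hom_id, Alg.comap_id, AlgHom.id_apply,
        AlgHom.id_apply] at h
  ext x
  simp only [RingHom.mem_ker, AlgHom.toRingHom_eq_coe, AlgHom.coe_toRingHom, AlgHom.comp_apply]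
  constructor
  · intro h
    exact hinj (h.trans (map_zero _).symm)
  · intro h
    change Alg.comap _ (Alg.comap (kerι _) x) = 0
    rw [show Alg.comap (kerι ((Over.pullback (Spec.map (CommRingCat.ofHom (algebraMap R S)))).map φ)) x = 0 from h, map_zero]

/-- **`J(φ_κ) ≤ spI (J(φ_K))`** — the kernel ideal of the special fibre lies in the specialisation of the generic kernel ideal (both are base changes of
`J(φ)`; `J(φ) ⊆ (K ⊗ J(φ)) ∩ Γ(G₁)`). [cite: EGAIV2, Prop. 2.8.5] [cite: Tate1997FiniteFlatGroupSchemes, (3.7)] -/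
theorem map_ker_counit_pullback_le_spI [IsMonHom φ] :
    (RingHom.ker (Bialgebra.counitAlgHom κ (Alg ((Over.pullback (Spec.map (CommRingCat.ofHom (algebraMap R κ)))).obj G₂)))).map
        (Alg.comap ((Over.pullback (Spec.map (CommRingCat.ofHom (algebraMap R κ)))).map φ)) ≤
      spI K κ G₁ ((RingHom.ker (Bialgebra.counitAlgHom K
          (Alg ((Over.pullback (Spec.map (CommRingCat.ofHom (algebraMap R K)))).obj G₂)))).map
        (Alg.comap ((Over.pullback (Spec.map (CommRingCat.ofHom (algebraMap R K)))).map φ))) := by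
  rw [spI_eq, ← comap_algBaseChangeEquiv_map_includeRight_map_ker_counit_eq φ K,
    ← comap_algBaseChangeEquiv_map_includeRight_map_ker_counit_eq φ κ,
    Ideal.map_comap_of_surjective _ (algBaseChangeEquiv K G₁).surjective]
  exact Ideal.comap_mono (Ideal.map_mono (Ideal.le_comap_map))

set_option synthInstance.maxHeartbeats 400000 in
/-- **HEAD — A HOMOMORPHISM KILLING A CLOSED SUBGROUP OF THE GENERIC FIBRE KILLS ITS SPECIALISATION**: for fields `K`, `κ` over `R` and an ideal
`J ⊂ Γ((G₁)_K)`, if `V(J) ↪ (G₁)_K` is killed by `φ_K` then `V(spI J) ↪ (G₁)_κ` is killed by `φ_κ` (§1 both ways, `map_ker_counit_pullback_le_spI`,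
`spI_mono`).  The `IsogKerLaw` ∕ reduced-roof kernel input of the cell's D-line `stub_DOWN`. [cite: EGAIV2, Prop. 2.8.5] [cite: Tate1997FiniteFlatGroupSchemes, (3.7)] -/
theorem quotIncl_spI_comp_eq_one [IsMonHom φ]
    (J : Ideal (Alg ((Over.pullback (Spec.map (CommRingCat.ofHom (algebraMap R K)))).obj G₁)))
    (hJ : quotIncl _ J ≫ (Over.pullback (Spec.map (CommRingCat.ofHom (algebraMap R K)))).map φ = 1) :
    quotIncl _ (spI K κ G₁ J) ≫ (Over.pullback (Spec.map (CommRingCat.ofHom (algebraMap R κ)))).map φ = 1 := by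
  rw [quotIncl_comp_eq_one_iff_map_ker_counit_le] at hJ ⊢
  exact (map_ker_counit_pullback_le_spI K κ φ).trans (spI_mono K κ hJ)

end Specialise


/-! ## §3 (ED. 2) Equality under flatness: the kernel of the special fibre IS the specialisation of the generic kernel -/

section Flat

variable {R : Type u} [CommRing R] (K κ : Type u) [Field K] [Algebra R K] [Field κ] [Algebra R κ]

/-- **A flat-quotient ideal is recovered from its generic fibre**: if `A ⧸ I` is `R`-flat and `R → K` is injective (e.g. `K = Frac R`), then
`(I·(K ⊗_R A)) ∩ A = I` along `includeRight : A → K ⊗_R A` (the image of `a` in `K ⊗_R (A ⧸ I)` vanishes, and `A ⧸ I → K ⊗_R (A ⧸ I)` is injective by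
flatness, Mathlib `Algebra.TensorProduct.includeRight_injective`). [cite: EGAIV2, Prop. 2.8.5] -/
theorem comap_map_includeRight_eq_self_of_flat_quotient {A : Type u} [CommRing A] [Algebra R A]
    (hK : Function.Injective (algebraMap R K)) (I : Ideal A) [Module.Flat R (A ⧸ I)] :
    (I.map (Algebra.TensorProduct.includeRight : A →ₐ[R] K ⊗[R] A)).comap
        (Algebra.TensorProduct.includeRight : A →ₐ[R] K ⊗[R] A) = I := by
  refine le_antisymm (fun a ha => ?_) Ideal.le_comap_map
  rw [Ideal.mem_comap] at ha
  have h1 : Algebra.TensorProduct.map (AlgHom.id K K) (Ideal.Quotient.mkₐ R I) (Algebra.TensorProduct.includeRight a) = 0 := by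
    have hle : I.map (Algebra.TensorProduct.includeRight : A →ₐ[R] K ⊗[R] A) ≤
        RingHom.ker (Algebra.TensorProduct.map (AlgHom.id K K) (Ideal.Quotient.mkₐ R I)) := by
      rw [Ideal.map_le_iff_le_comap]
      intro x hx
      rw [Ideal.mem_comap, RingHom.mem_ker, Algebra.TensorProduct.includeRight_apply, Algebra.TensorProduct.map_tmul, AlgHom.id_apply,
        Ideal.Quotient.mkₐ_eq_mk, Ideal.Quotient.eq_zero_iff_mem.mpr hx, TensorProduct.tmul_zero]
    exact hle ha
  rw [Algebra.TensorProduct.includeRight_apply, Algebra.TensorProduct.map_tmul, AlgHom.id_apply, Ideal.Quotient.mkₐ_eq_mk] at h1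
  have hinj : Function.Injective (Algebra.TensorProduct.includeRight : (A ⧸ I) →ₐ[R] K ⊗[R] (A ⧸ I)) :=
    Algebra.TensorProduct.includeRight_injective hK
  have h2 : (Ideal.Quotient.mk I a) = 0 := hinj (by rw [Algebra.TensorProduct.includeRight_apply, h1, map_zero])
  exact Ideal.Quotient.eq_zero_iff_mem.mp h2

variable {G₁ G₂ : SchemeOver R} [GrpObj G₁] [GrpObj G₂] [IsAffine G₁.left] [IsAffine G₂.left] (φ : G₁ ⟶ G₂)
  [IsAffine ((Over.pullback (Spec.map (CommRingCat.ofHom (algebraMap R K)))).obj G₁).left]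
  [IsAffine ((Over.pullback (Spec.map (CommRingCat.ofHom (algebraMap R κ)))).obj G₁).left]
  [IsAffine ((Over.pullback (Spec.map (CommRingCat.ofHom (algebraMap R K)))).obj G₂).left]
  [IsAffine ((Over.pullback (Spec.map (CommRingCat.ofHom (algebraMap R κ)))).obj G₂).left]

/-- **HEAD (ED. 2) — THE KERNEL OF THE SPECIAL FIBRE IS THE SPECIALISATION OF THE GENERIC KERNEL**: `spI (J(φ_K)) = J(φ_κ)` when
`Γ(Ker φ) = Γ(G₁) ⧸ J(φ)` is `R`-FLAT and `R → K` is injective (e.g. `R` a valuation ring with fraction field `K`: `Ker φ` is then the flat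
(schematic) closure of `Ker (φ_K)`, [EGAIV2] 2.8.5) — §2 both ways + `comap_map_includeRight_eq_self_of_flat_quotient`.
[cite: EGAIV2, Prop. 2.8.5] [cite: Tate1997FiniteFlatGroupSchemes, (3.7)] -/
theorem spI_map_ker_counit_pullback_eq [IsMonHom φ] (hK : Function.Injective (algebraMap R K))
    [Module.Flat R (Alg G₁ ⧸ (RingHom.ker (Bialgebra.counitAlgHom R (Alg G₂))).map (Alg.comap φ))] :
    spI K κ G₁ ((RingHom.ker (Bialgebra.counitAlgHom K
          (Alg ((Over.pullback (Spec.map (CommRingCat.ofHom (algebraMap R K)))).obj G₂)))).map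
        (Alg.comap ((Over.pullback (Spec.map (CommRingCat.ofHom (algebraMap R K)))).map φ))) =
      (RingHom.ker (Bialgebra.counitAlgHom κ (Alg ((Over.pullback (Spec.map (CommRingCat.ofHom (algebraMap R κ)))).obj G₂)))).map
        (Alg.comap ((Over.pullback (Spec.map (CommRingCat.ofHom (algebraMap R κ)))).map φ)) := by
  rw [spI_eq, ← comap_algBaseChangeEquiv_map_includeRight_map_ker_counit_eq φ K,
    ← comap_algBaseChangeEquiv_map_includeRight_map_ker_counit_eq φ κ,
    Ideal.map_comap_of_surjective _ (algBaseChangeEquiv K G₁).surjective,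
    comap_map_includeRight_eq_self_of_flat_quotient K hK]

end Flat

end AffineGroupScheme

end Literature.AlgebraicGeometry.GroupSchemes

end
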